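import Mathlib.Analysis.SpecialFunctions.Gaussian.GaussianIntegral
import Mathlib.MeasureTheory.Integral.Gamma
import Mathlib.MeasureTheory.Integral.Prod
import Mathlib.MeasureTheory.Integral.ExpDecay
import Mathlib.Analysis.SpecialFunctions.ImproperIntegrals
import Mathlib.Analysis.SpecialFunctions.Exponential
import Literature.Analysis.FunctionSpaces.BesselJProofs
import HarnessLib

/-!
# Weber's first exponential integral for `J₁` and the bound `c² ∫₀^∞ J₁(ω)/(ω²+c²) dω < 1`

For the Bessel function `Literature.besselJ 1` of `Literature.Analysis.FunctionSpaces.BesselJ` (power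
series definition) we prove

* `Literature.Analysis.FunctionSpaces.integral_exp_neg_mul_sq_mul_besselJ_one` — the **Weber–Hankel exponential integral** at
  order one: `∫₀^∞ e^{-uω²} J₁(ω) dω = 1 - e^{-1/(4u)}` for `u > 0`. This is the case
  `ν = μ = 1`, `a = 1`, `p² = u` of Hankel's formula
  `∫₀^∞ J_ν(at) t^{μ-1} e^{-p²t²} dt = Γ((μ+ν)/2) (a/2p)^ν / (2 p^μ Γ(ν+1)) ₁F₁((μ+ν)/2; ν+1; -a²/4p²)`
  (Andrews–Askey–Roy, *Special Functions*, Theorem 4.11.7, eq. (4.11.23)), since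
  `₁F₁(1; 2; -x) = (1 - e^{-x})/x`. As in loc. cit., the proof is term-wise integration of the
  series `J₁(ω) = ∑ (-1)^k (ω/2)^{2k+1} / (k!(k+1)!)` against the Gaussian
  (`∫₀^∞ ω^{2k+1} e^{-uω²} dω = k!/(2u^{k+1})`), the interchange being justified by
  `∑_k ∫₀^∞ e^{-uω²} (ω/2)^{2k+1}/(k!(k+1)!) dω = e^{1/(4u)} - 1 < ∞`;
* `Literature.Analysis.FunctionSpaces.integral_besselJ_one_div_sq_add_sq` — for `c ≠ 0`,
  `∫₀^∞ J₁(ω)/(ω²+c²) dω = ∫₀^∞ e^{-c²u} (1 - e^{-1/(4u)}) du`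
  (subordination `1/(ω²+c²) = ∫₀^∞ e^{-(ω²+c²)u} du` and Fubini; the right-hand side equals
  `(1 - c K₁(c))/c²` in terms of the modified Bessel function `K₁`, which we do not need);
* `Literature.Analysis.FunctionSpaces.sq_mul_integral_besselJ_one_div_sq_add_sq_lt_one` — hence
  `c² ∫₀^∞ J₁(ω)/(ω²+c²) dω = 1 - c² ∫₀^∞ e^{-c²u - 1/(4u)} du < 1` for `c ≠ 0`, and
  `Literature.Analysis.FunctionSpaces.integral_besselJ_one_div_sq_add_sq_nonneg` — `0 ≤ ∫₀^∞ J₁(ω)/(ω²+c²) dω`.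

The last bound, applied at `c = (2k+1)π/a`, is the positivity input for the Lieb–Wu charge gap of
the half-filled Hubbard chain (`Literature.Analysis.FunctionSpaces.LiebWuChargeGapProofs`): it says
that each term of the partial-fraction expansion of the Fermi factor contributes less than its
`U = 0` value.

## References

* G. E. Andrews, R. Askey, R. Roy, *Special Functions* (Cambridge, 1999), §4.11, Theorem 4.11.7,
  eq. (4.11.23) (Hankel's exponential integral, proved there by term-wise integration),
  and eq. (4.11.25) (Weber's first exponential integral); see Watson, *A Treatise on the Theory of
  Bessel Functions* (1944), §13.3, for the history.
* E. H. Lieb, F. Y. Wu, Physica A 321 (2003) 1–27, §7 (where the positivity of the charge gap is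
  obtained instead from a contour-integral representation).
-/

noncomputable section

open scoped Topology Nat
open Filter Set MeasureTheory Real

namespace Literature.Analysis.FunctionSpaces

/-! ## Gaussian moments and the exponential integral on `(0, ∞)` -/

/-- `∫₀^∞ ω^{2k+1} e^{-uω²} dω = k! / (2u^{k+1})` for `u > 0` (substitute `t = ω²` in Euler's
integral for `Γ(k+1)`). [folklore] -/
theorem integral_pow_odd_mul_exp_neg_mul_sq {u : ℝ} (hu : 0 < u) (k : ℕ) :
    ∫ ω in Ioi (0 : ℝ), ω ^ (2 * k + 1) * exp (-(u * ω ^ 2)) = k ! / (2 * u ^ (k + 1)) := by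
  have h := integral_rpow_mul_exp_neg_mul_rpow (p := 2) (q := 2 * k + 1) (b := u) two_pos
    (by have := k.cast_nonneg (α := ℝ); linarith) hu
  have hlhs : ∫ ω in Ioi (0 : ℝ), ω ^ (2 * k + 1) * exp (-(u * ω ^ 2)) =
      ∫ x in Ioi (0 : ℝ), x ^ (2 * (k : ℝ) + 1) * exp (-u * x ^ (2 : ℝ)) := by
    refine setIntegral_congr_fun measurableSet_Ioi fun x _ => ?_
    rw [Real.rpow_two, neg_mul]
    norm_cast
  have e1 : (2 * (k : ℝ) + 1 + 1) / 2 = (k : ℝ) + 1 := by ring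
  have e2 : -(2 * (k : ℝ) + 1 + 1) / 2 = -((k : ℝ) + 1) := by ring
  rw [e1, e2, Real.Gamma_nat_eq_factorial, Real.rpow_neg hu.le, ← Nat.cast_succ,
    Real.rpow_natCast] at h
  rw [hlhs, h]
  field_simp

/-- `∫₀^∞ e^{-l u} du = 1/l` for `l > 0`. [folklore] -/
theorem integral_exp_neg_mul_Ioi {l : ℝ} (hl : 0 < l) :
    ∫ u in Ioi (0 : ℝ), exp (-(l * u)) = 1 / l := by
  have h := integral_exp_mul_Ioi (a := -l) (by linarith) 0
  simp only [mul_zero, exp_zero, neg_mul] at h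
  rw [h, neg_div_neg_eq]

/-- `u ↦ e^{-l u}` is integrable on `(0, ∞)` for `l > 0`. [folklore] -/
theorem integrableOn_exp_neg_mul_Ioi {l : ℝ} (hl : 0 < l) :
    IntegrableOn (fun u : ℝ => exp (-(l * u))) (Ioi 0) := by
  have h := exp_neg_integrableOn_Ioi 0 hl
  simpa only [neg_mul] using h

/-! ## Term-wise integration of the Bessel series against the Gaussian -/

/-- The `k`-th term of `e^{-uω²} J₁(ω)`:
`e^{-uω²} (-1)^k (ω/2)^{2k+1} / (k!(k+1)!) = [(-1)^k / (k!(k+1)! 2^{2k+1})] ω^{2k+1} e^{-uω²}`. [folklore] -/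
theorem exp_neg_mul_sq_mul_besselJTerm_one (u ω : ℝ) (k : ℕ) :
    exp (-(u * ω ^ 2)) * besselJTerm 1 ω k =
      (-1) ^ k / ((k ! : ℝ) * (k + 1)! * 2 ^ (2 * k + 1)) * (ω ^ (2 * k + 1) * exp (-(u * ω ^ 2))) := by
  simp only [besselJTerm, div_pow]
  ring

/-- `∫₀^∞ e^{-uω²} [(-1)^k (ω/2)^{2k+1} / (k!(k+1)!)] dω = (-1)^k / ((k+1)! (4u)^{k+1})` for `u > 0`. [folklore] -/
theorem integral_exp_neg_mul_sq_mul_besselJTerm_one {u : ℝ} (hu : 0 < u) (k : ℕ) :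
    ∫ ω in Ioi (0 : ℝ), exp (-(u * ω ^ 2)) * besselJTerm 1 ω k =
      (-1) ^ k / (((k + 1)! : ℝ) * (4 * u) ^ (k + 1)) := by
  simp_rw [exp_neg_mul_sq_mul_besselJTerm_one]
  rw [integral_const_mul, integral_pow_odd_mul_exp_neg_mul_sq hu k]
  have hk : (k ! : ℝ) ≠ 0 := by positivity
  have h4 : (4 * u) ^ (k + 1) = 2 ^ (2 * k + 1) * 2 * u ^ (k + 1) := by
    rw [mul_pow, ← pow_succ, show 2 * k + 1 + 1 = 2 * (k + 1) by ring, pow_mul]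
    norm_num
  rw [h4]
  field_simp

/-- The norm of the `k`-th term on `(0, ∞)`: `[1 / (k!(k+1)! 2^{2k+1})] ω^{2k+1} e^{-uω²}`. [folklore] -/
theorem norm_exp_neg_mul_sq_mul_besselJTerm_one (u : ℝ) {ω : ℝ} (hω : 0 ≤ ω) (k : ℕ) :
    ‖exp (-(u * ω ^ 2)) * besselJTerm 1 ω k‖ =
      1 / ((k ! : ℝ) * (k + 1)! * 2 ^ (2 * k + 1)) * (ω ^ (2 * k + 1) * exp (-(u * ω ^ 2))) := by
  rw [exp_neg_mul_sq_mul_besselJTerm_one, norm_mul, norm_div, norm_pow, norm_neg, norm_one, one_pow,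
    Real.norm_of_nonneg (by positivity : (0 : ℝ) ≤ (k ! : ℝ) * (k + 1)! * 2 ^ (2 * k + 1)),
    Real.norm_of_nonneg (by positivity : (0 : ℝ) ≤ ω ^ (2 * k + 1) * exp (-(u * ω ^ 2)))]

/-- Each term `e^{-uω²} (-1)^k (ω/2)^{2k+1}/(k!(k+1)!)` is integrable on `(0, ∞)` for `u > 0`. [folklore] -/
theorem integrableOn_exp_neg_mul_sq_mul_besselJTerm_one {u : ℝ} (hu : 0 < u) (k : ℕ) :
    IntegrableOn (fun ω : ℝ => exp (-(u * ω ^ 2)) * besselJTerm 1 ω k) (Ioi 0) := by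
  have h0 : IntegrableOn (fun ω : ℝ => ω ^ (2 * k + 1) * exp (-(u * ω ^ 2))) (Ioi 0) := by
    have h := integrableOn_rpow_mul_exp_neg_mul_rpow (s := 2 * k + 1) (p := 2) (b := u)
      (by have := k.cast_nonneg (α := ℝ); linarith) (by norm_num) hu
    refine h.congr_fun (fun ω _ => ?_) measurableSet_Ioi
    simp only [Real.rpow_two, neg_mul]
    norm_cast
  simp_rw [exp_neg_mul_sq_mul_besselJTerm_one]
  exact h0.const_mul _

/-- `∫₀^∞ ‖e^{-uω²} (-1)^k (ω/2)^{2k+1}/(k!(k+1)!)‖ dω = 1 / ((k+1)! (4u)^{k+1})` for `u > 0`. [folklore] -/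
theorem integral_norm_exp_neg_mul_sq_mul_besselJTerm_one {u : ℝ} (hu : 0 < u) (k : ℕ) :
    ∫ ω in Ioi (0 : ℝ), ‖exp (-(u * ω ^ 2)) * besselJTerm 1 ω k‖ =
      1 / (((k + 1)! : ℝ) * (4 * u) ^ (k + 1)) := by
  rw [setIntegral_congr_fun measurableSet_Ioi
    (fun ω (hω : 0 < ω) => norm_exp_neg_mul_sq_mul_besselJTerm_one u hω.le k),
    integral_const_mul, integral_pow_odd_mul_exp_neg_mul_sq hu k]
  have hk : (k ! : ℝ) ≠ 0 := by positivity
  have h4 : (4 * u) ^ (k + 1) = 2 ^ (2 * k + 1) * 2 * u ^ (k + 1) := by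
    rw [mul_pow, ← pow_succ, show 2 * k + 1 + 1 = 2 * (k + 1) by ring, pow_mul]
    norm_num
  rw [h4]
  field_simp

/-- The alternating exponential series without its constant term:
`∑_{k ≥ 0} (-1)^k x^{k+1}/(k+1)! = 1 - e^{-x}`. [folklore] -/
theorem hasSum_neg_one_pow_mul_pow_succ_div_factorial (x : ℝ) :
    HasSum (fun k : ℕ => (-1) ^ k * (x ^ (k + 1) / ((k + 1)! : ℝ))) (1 - exp (-x)) := by
  have h0 : HasSum (fun n : ℕ => (-x) ^ n / (n ! : ℝ)) (exp (-x)) := by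
    rw [Real.exp_eq_exp_ℝ]
    exact NormedSpace.expSeries_div_hasSum_exp (-x)
  have h1 := ((hasSum_nat_add_iff' 1).mpr h0).neg
  simp only [Finset.range_one, Finset.sum_singleton, pow_zero, Nat.factorial_zero, Nat.cast_one,
    div_one, neg_sub] at h1
  refine h1.congr_fun fun k => ?_
  rw [neg_pow x (k + 1), pow_succ (-1 : ℝ) k]
  ring

/-- **The Weber–Hankel exponential integral** at order one:
`∫₀^∞ e^{-uω²} J₁(ω) dω = 1 - e^{-1/(4u)}` for `u > 0` (Andrews–Askey–Roy, Theorem 4.11.7,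
eq. (4.11.23) with `ν = μ = 1`, `a = 1`, `p² = u`, where `₁F₁(1; 2; -x) = (1 - e^{-x})/x`), by
term-wise integration of the Bessel series. [cite: AndrewsAskeyRoy1999, §4.11 Thm 4.11.7 (4.11.23)] -/
theorem integral_exp_neg_mul_sq_mul_besselJ_one {u : ℝ} (hu : 0 < u) :
    ∫ ω in Ioi (0 : ℝ), exp (-(u * ω ^ 2)) * besselJ 1 ω = 1 - exp (-(1 / (4 * u))) := by
  have hint : ∀ k, Integrable (fun ω : ℝ => exp (-(u * ω ^ 2)) * besselJTerm 1 ω k)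
      (volume.restrict (Ioi 0)) :=
    fun k => integrableOn_exp_neg_mul_sq_mul_besselJTerm_one hu k
  have hsum : Summable fun k => ∫ ω in Ioi (0 : ℝ), ‖exp (-(u * ω ^ 2)) * besselJTerm 1 ω k‖ := by
    simp_rw [integral_norm_exp_neg_mul_sq_mul_besselJTerm_one hu]
    have h := (summable_nat_add_iff 1).mpr (Real.summable_pow_div_factorial (1 / (4 * u)))
    refine h.congr fun k => ?_
    rw [one_div_pow]
    ring
  have hswap := integral_tsum_of_summable_integral_norm hint hsum
  have htsum : ∀ ω : ℝ, ∑' k, exp (-(u * ω ^ 2)) * besselJTerm 1 ω k = exp (-(u * ω ^ 2)) * besselJ 1 ω :=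
    fun ω => ((hasSum_besselJ_holds 1 ω).mul_left _).tsum_eq
  simp_rw [htsum, integral_exp_neg_mul_sq_mul_besselJTerm_one hu] at hswap
  rw [← hswap]
  refine (hasSum_neg_one_pow_mul_pow_succ_div_factorial (1 / (4 * u))).tsum_eq.symm ▸ ?_
  · congr 1
    funext k
    rw [one_div_pow]
    ring

/-! ## The resolvent integral `∫₀^∞ J₁(ω)/(ω²+c²) dω` -/

/-- `|J₁(ω)|/(ω²+c²)` is integrable on `(0, ∞)` for `c ≠ 0` (`|J₁| ≤ 1`, Cauchy tail). [folklore] -/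
theorem integrableOn_abs_besselJ_one_div_sq_add_sq {c : ℝ} (hc : c ≠ 0) :
    IntegrableOn (fun ω : ℝ => |besselJ 1 ω| / (ω ^ 2 + c ^ 2)) (Ioi 0) := by
  have hc2 : 0 < c ^ 2 := by positivity
  set m : ℝ := max 1 (1 / c ^ 2) with hm
  have hm1 : 1 ≤ m := le_max_left _ _
  have hm2 : 1 / c ^ 2 ≤ m := le_max_right _ _
  have hdom : IntegrableOn (fun ω : ℝ => m * (1 + ω ^ 2)⁻¹) (Ioi 0) :=
    (integrable_inv_one_add_sq.const_mul m).integrableOn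
  have hcont : Continuous fun ω : ℝ => |besselJ 1 ω| / (ω ^ 2 + c ^ 2) :=
    ((continuous_besselJ_holds 1).abs).div (by fun_prop) fun ω => by positivity
  refine Integrable.mono' hdom hcont.aestronglyMeasurable (ae_of_all _ fun ω => ?_)
  have hden : 0 < ω ^ 2 + c ^ 2 := by positivity
  rw [Real.norm_eq_abs, abs_div, abs_abs, abs_of_pos hden]
  calc |besselJ 1 ω| / (ω ^ 2 + c ^ 2) ≤ 1 / (ω ^ 2 + c ^ 2) := by
        gcongr; exact abs_besselJ_one_le_one ω
    _ ≤ m * (1 + ω ^ 2)⁻¹ := by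
        rw [← div_eq_mul_inv, div_le_div_iff₀ hden (by positivity), one_mul]
        have h1 : 1 ≤ m * c ^ 2 := by
          rw [div_le_iff₀ hc2] at hm2; linarith
        nlinarith [sq_nonneg ω]

/-- **Subordinated form of the resolvent integral**: for `c ≠ 0`,
`∫₀^∞ J₁(ω)/(ω²+c²) dω = ∫₀^∞ e^{-c²u} (1 - e^{-1/(4u)}) du`, from
`1/(ω²+c²) = ∫₀^∞ e^{-(ω²+c²)u} du`, Fubini, and the Weber–Hankel integral
`∫₀^∞ e^{-uω²} J₁(ω) dω = 1 - e^{-1/(4u)}` (Andrews–Askey–Roy (4.11.23)). [cite: AndrewsAskeyRoy1999, §4.11 Thm 4.11.7 (4.11.23)] -/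
theorem integral_besselJ_one_div_sq_add_sq {c : ℝ} (hc : c ≠ 0) :
    ∫ ω in Ioi (0 : ℝ), besselJ 1 ω / (ω ^ 2 + c ^ 2) =
      ∫ u in Ioi (0 : ℝ), exp (-(c ^ 2 * u)) * (1 - exp (-(1 / (4 * u)))) := by
  have hc2 : 0 < c ^ 2 := by positivity
  have hinner : ∀ ω : ℝ, ∫ u in Ioi (0 : ℝ), besselJ 1 ω * exp (-((ω ^ 2 + c ^ 2) * u)) =
      besselJ 1 ω / (ω ^ 2 + c ^ 2) := by
    intro ω
    have hl : 0 < ω ^ 2 + c ^ 2 := by positivity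
    rw [integral_const_mul, integral_exp_neg_mul_Ioi hl]
    ring
  have hprod : Integrable (Function.uncurry fun ω u : ℝ => besselJ 1 ω * exp (-((ω ^ 2 + c ^ 2) * u)))
      ((volume.restrict (Ioi (0 : ℝ))).prod (volume.restrict (Ioi (0 : ℝ)))) := by
    refine (integrable_prod_iff ?_).mpr ⟨?_, ?_⟩
    · have h1 : Continuous fun p : ℝ × ℝ => besselJ 1 p.1 :=
        (continuous_besselJ_holds 1).comp continuous_fst
      have h2 : Continuous fun p : ℝ × ℝ => exp (-((p.1 ^ 2 + c ^ 2) * p.2)) := by fun_prop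
      exact (h1.mul h2).aestronglyMeasurable
    · refine ae_of_all _ fun ω => ?_
      have hl : 0 < ω ^ 2 + c ^ 2 := by positivity
      exact (integrableOn_exp_neg_mul_Ioi hl).const_mul (besselJ 1 ω)
    · have heq : ∀ ω : ℝ, ∫ u in Ioi (0 : ℝ), ‖besselJ 1 ω * exp (-((ω ^ 2 + c ^ 2) * u))‖ =
          |besselJ 1 ω| / (ω ^ 2 + c ^ 2) := by
        intro ω
        have hl : 0 < ω ^ 2 + c ^ 2 := by positivity
        simp_rw [norm_mul, Real.norm_eq_abs, abs_of_pos (exp_pos _)]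
        rw [integral_const_mul, integral_exp_neg_mul_Ioi hl]
        ring
      simp_rw [Function.uncurry, heq]
      exact integrableOn_abs_besselJ_one_div_sq_add_sq hc
  calc ∫ ω in Ioi (0 : ℝ), besselJ 1 ω / (ω ^ 2 + c ^ 2)
      = ∫ ω in Ioi (0 : ℝ), ∫ u in Ioi (0 : ℝ), besselJ 1 ω * exp (-((ω ^ 2 + c ^ 2) * u)) := by
        simp_rw [hinner]
    _ = ∫ u in Ioi (0 : ℝ), ∫ ω in Ioi (0 : ℝ), besselJ 1 ω * exp (-((ω ^ 2 + c ^ 2) * u)) :=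
        integral_integral_swap hprod
    _ = ∫ u in Ioi (0 : ℝ), exp (-(c ^ 2 * u)) * (1 - exp (-(1 / (4 * u)))) := by
        refine setIntegral_congr_fun measurableSet_Ioi fun u (hu : 0 < u) => ?_
        have h : ∀ ω : ℝ, besselJ 1 ω * exp (-((ω ^ 2 + c ^ 2) * u)) =
            exp (-(c ^ 2 * u)) * (exp (-(u * ω ^ 2)) * besselJ 1 ω) := by
          intro ω
          rw [show -((ω ^ 2 + c ^ 2) * u) = -(c ^ 2 * u) + -(u * ω ^ 2) by ring, exp_add]
          ring
        simp_rw [h]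
        rw [integral_const_mul, integral_exp_neg_mul_sq_mul_besselJ_one hu]

/-- `u ↦ e^{-c²u} e^{-1/(4u)}` is integrable on `(0, ∞)` for `c ≠ 0`. [folklore] -/
theorem integrableOn_exp_neg_sq_mul_mul_exp_neg_inv {c : ℝ} (hc : c ≠ 0) :
    IntegrableOn (fun u : ℝ => exp (-(c ^ 2 * u)) * exp (-(1 / (4 * u)))) (Ioi 0) := by
  have hc2 : 0 < c ^ 2 := by positivity
  refine Integrable.mul_bdd (c := 1) (integrableOn_exp_neg_mul_Ioi hc2)
    (by fun_prop : Measurable fun u : ℝ => exp (-(1 / (4 * u)))).aestronglyMeasurable ?_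
  refine ae_restrict_of_forall_mem measurableSet_Ioi fun u (hu : 0 < u) => ?_
  rw [Real.norm_eq_abs, abs_of_pos (exp_pos _), exp_le_one_iff, neg_nonpos]
  positivity

/-- **The resolvent bound**: for `c ≠ 0`,
`c² ∫₀^∞ J₁(ω)/(ω²+c²) dω = 1 - c² ∫₀^∞ e^{-c²u - 1/(4u)} du < 1`
(equivalently `c K₁(c) > 0`), from `Literature.Analysis.FunctionSpaces.integral_besselJ_one_div_sq_add_sq`. [folklore] -/
theorem sq_mul_integral_besselJ_one_div_sq_add_sq_lt_one {c : ℝ} (hc : c ≠ 0) :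
    c ^ 2 * ∫ ω in Ioi (0 : ℝ), besselJ 1 ω / (ω ^ 2 + c ^ 2) < 1 := by
  have hc2 : 0 < c ^ 2 := by positivity
  have h1 : IntegrableOn (fun u : ℝ => exp (-(c ^ 2 * u))) (Ioi 0) := integrableOn_exp_neg_mul_Ioi hc2
  have h2 := integrableOn_exp_neg_sq_mul_mul_exp_neg_inv hc
  have hsplit : ∫ u in Ioi (0 : ℝ), exp (-(c ^ 2 * u)) * (1 - exp (-(1 / (4 * u)))) =
      1 / c ^ 2 - ∫ u in Ioi (0 : ℝ), exp (-(c ^ 2 * u)) * exp (-(1 / (4 * u))) := by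
    simp_rw [mul_sub, mul_one]
    rw [integral_sub h1 h2, integral_exp_neg_mul_Ioi hc2]
  rw [integral_besselJ_one_div_sq_add_sq hc, hsplit, mul_sub, mul_one_div_cancel hc2.ne',
    sub_lt_self_iff]
  refine mul_pos hc2 ?_
  have hpos : ∀ᵐ u ∂(volume.restrict (Ioi (0 : ℝ))),
      0 ≤ exp (-(c ^ 2 * u)) * exp (-(1 / (4 * u))) :=
    ae_of_all _ fun u => by positivity
  haveI : NeZero (volume (Ioi (0 : ℝ))) := ⟨by simp⟩
  have h3 : Integrable (fun u : ℝ => exp (-(c ^ 2 * u) + -(1 / (4 * u)))) (volume.restrict (Ioi 0)) :=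
    h2.congr (ae_of_all _ fun u => by simp only [exp_add])
  have h4 := integral_exp_pos h3
  simp_rw [exp_add] at h4
  exact h4

/-- `0 ≤ ∫₀^∞ J₁(ω)/(ω²+c²) dω` for `c ≠ 0` (the subordinated integrand
`e^{-c²u} (1 - e^{-1/(4u)})` is non-negative). [folklore] -/
theorem integral_besselJ_one_div_sq_add_sq_nonneg {c : ℝ} (hc : c ≠ 0) :
    0 ≤ ∫ ω in Ioi (0 : ℝ), besselJ 1 ω / (ω ^ 2 + c ^ 2) := by
  rw [integral_besselJ_one_div_sq_add_sq hc]
  refine setIntegral_nonneg measurableSet_Ioi fun u (hu : 0 < u) => mul_nonneg (exp_pos _).le ?_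
  rw [sub_nonneg, exp_le_one_iff, neg_nonpos]
  positivity

end Literature.Analysis.FunctionSpaces
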